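import Summits.QuantumFields.YangMills.Theorems.BalabanLadderUVSeamRecTorusOneLoopFloor
import HarnessLib

/-!
# Crux `UVSeamRec` (stmt-QuantumFields-20043): ONE-LOOP COLD-WALL EXTREMALITY IN THE CRUX'S LETTERS — a rung under CWX of the line «extremal_coldwall»

Helper file (`--supports stmt-QuantumFields-20043`) of the LEAD seat `ym-spine-20043-p1` (gen 15), sequel of `…TorusOneLoopFloor` (route letters:
`kernelMean_one_le_kernelMean_add_of_crudeGood`, the cold wall minimises the one-loop centre deficit among crude-good data of the box `⌈β^θ⌉`) and of
`…ColdWallSplitCrudeGood` (dictionary crux ↔ route: `kerE_plane_eq_origin_perm`, `kerE_plane_centre_eq`, `crudeGood_configShift_of_coronaGood`).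
**`kerE_plane_le_kerE_one_plane_add_of_coronaGood_polyTop`**: for `0 < θ ≤ θ₀`, eventually in `β`, `R + 1 = ⌈β^θ⌉`, every plane, site and every exterior
whose plaquettes based in the corona range have deficit `≤ β^{2θ/5−1}`:  `kerE^η(plane q x) ≤ kerE^𝟙(plane q x) + 2β^{−1−θ}` — the sentence of the stub
`stub_coldWallExtremal` (CWX) of `Lines/extremal_coldwall.lean` (ym-idea-10) with tolerance `2β^{−1−θ}`, on the top scale of the polynomial window, for
corona-good exteriors.  Gen 12: exact CWX ⇒ Tier 3 (`kerE_one_deficit_le_torusE_of_extremal`).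
HONEST FRAMING: the near-flat, top-scale corner of CWX only; nothing of E0′, NT or the gap; YM mass gap NOT proved; not Clay.
-/

set_option autoImplicit false

noncomputable section

open MeasureTheory Finset Filter Topology
open Literature.Probability.LatticeModels (Site)
open Literature.MathematicalPhysics.QuantumLattice (LGConfig fundamentalRep fundamentalLatticeRep configShift)
open Summit.QuantumFields.YangMills.Theorems.WeakCouplingRates
open Summit.QuantumFields.YangMills.Cruxes.OSLegsFromFemtoAndGap.DlrCollarTransfer (kerE plane)

namespace Summit.QuantumFields.YangMills.Cruxes.UVSeamRec.ClassicalResponse.ColdWall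

/-- **ONE-LOOP COLD-WALL EXTREMALITY IN THE CRUX'S LETTERS.**  There is `θ₀ ∈ (0, 1/100]` such that for all `0 < θ ≤ θ₀` there is `β₂ > 0` with: for all
`β ≥ β₂`, all `R` with `R + 1 = ⌈β^θ⌉`, every plane `q.1 < q.2`, site `x`, and every exterior `η` each of whose plaquettes based in the corona range
`[x − R − 2, x + R + 2]⁴` has deficit `≤ β^{2θ/5−1}`:  `kerE^η_{β,(x−R−1,2R+3)}(plane q x) ≤ kerE^𝟙_{β,(x−R−1,2R+3)}(plane q x) + 2β^{−1−θ}` — the sentence of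
the stub `stub_coldWallExtremal` (CWX) of `Lines/extremal_coldwall.lean`, with tolerance `2β^{−1−θ}`, on the top scale of the polynomial window, for corona-good
exteriors (the expansion's classical term `β·Σ_c F̄_c(x)²` is a square).  By gen 12's `kerE_one_deficit_le_torusE_of_extremal`, exact CWX would give Tier 3. [folklore] -/
theorem kerE_plane_le_kerE_one_plane_add_of_coronaGood_polyTop :
    ∃ θ₀ : ℝ, 0 < θ₀ ∧ θ₀ ≤ 1 / 100 ∧ ∀ θ : ℝ, 0 < θ → θ ≤ θ₀ → ∃ β₂ : ℝ, 0 < β₂ ∧ ∀ β : ℝ, β₂ ≤ β →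
      ∀ R : ℕ, R + 1 = ⌈β ^ θ⌉₊ → ∀ (q : Fin 4 × Fin 4) (x : Fin 4 → ℤ), q.1 < q.2 →
      ∀ η : LGConfig 4 (Matrix.specialUnitaryGroup (Fin 2) ℂ),
        (∀ y : Fin 4 → ℤ, (∀ k : Fin 4, x k - R - 2 ≤ y k ∧ y k ≤ x k + R + 2) → ∀ i j : Fin 4, i < j →
          2 - plane (Matrix.specialUnitaryGroup (Fin 2) ℂ) (fundamentalLatticeRep 2) (i, j) y η ≤ β ^ (2 * (θ / 5) - 1)) →
        kerE (Matrix.specialUnitaryGroup (Fin 2) ℂ) (fundamentalLatticeRep 2) β (fun k => x k - (R + 1)) (2 * R + 3) η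
            (plane (Matrix.specialUnitaryGroup (Fin 2) ℂ) (fundamentalLatticeRep 2) q x) ≤
          kerE (Matrix.specialUnitaryGroup (Fin 2) ℂ) (fundamentalLatticeRep 2) β (fun k => x k - (R + 1)) (2 * R + 3) 1
            (plane (Matrix.specialUnitaryGroup (Fin 2) ℂ) (fundamentalLatticeRep 2) q x) + 2 * β ^ (-1 - θ) := by
  obtain ⟨θ₀, hθ₀, hθ₀', hA⟩ := kernelMean_one_le_kernelMean_add_of_crudeGood
  refine ⟨θ₀, hθ₀, hθ₀', fun θ hθ hθle => ?_⟩
  obtain ⟨β₀, hβ₀⟩ := hA θ hθ hθle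
  refine ⟨max β₀ 1, lt_of_lt_of_le one_pos (le_max_right _ _), fun β hβ R hR q x hq η hη => ?_⟩
  have hb0 : β₀ ≤ β := (le_max_left _ _).trans hβ
  obtain ⟨σ, h1, h2⟩ := exists_perm_one_two (ne_of_lt hq)
  -- the exterior moved to the origin cube and the `(1,2)`-plane is a crude-good datum of the box `⌈β^θ⌉`
  have hg : CrudeGood β (θ / 5) ⌈β ^ θ⌉₊ ((Literature.MathematicalPhysics.QuantumLattice.relabelConfig
      (Literature.MathematicalPhysics.QuantumLattice.edgePerm σ)).symm (configShift (fun k => ((R : ℤ) + 1) - x k) η)) := by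
    rw [relabelConfig_edgePerm_symm_apply, ← hR]
    exact crudeGood_relabel_edgePerm σ.symm (crudeGood_configShift_of_coronaGood hη)
  have hcast : ((⌈β ^ θ⌉₊ : ℕ) : ℤ) = (R : ℤ) + 1 := by rw [← hR]; push_cast; ring
  have hcentre : ∀ m : Fin 4, 8 * |(fun _ : Fin 4 => (R : ℤ) + 1) m - (⌈β ^ θ⌉₊ : ℤ)| ≤ (⌈β ^ θ⌉₊ : ℤ) := fun m => by
    rw [hcast]; simp only [sub_self, abs_zero, mul_zero]; positivity
  have hm := hβ₀ β hb0 _ hg (fun _ => (R : ℤ) + 1) hcentre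
  -- the cold wall moved likewise is the cold wall
  have h1' : (Literature.MathematicalPhysics.QuantumLattice.relabelConfig (Literature.MathematicalPhysics.QuantumLattice.edgePerm σ)).symm (configShift (fun k => ((R : ℤ) + 1) - x k)
      (1 : LGConfig 4 (Matrix.specialUnitaryGroup (Fin 2) ℂ))) = 1 := by
    funext e; rfl
  rw [kerE_plane_eq_origin_perm β R q x η σ h1 h2, kerE_plane_eq_origin_perm β R q x 1 σ h1 h2, h1', kerE_plane_centre_eq,
    kerE_plane_centre_eq, hR]
  have hm' : ∫ U, plaqCostAt (fundamentalRep (Fin 2)) (fun _ => (R : ℤ) + 1) 1 2 U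
        ∂(boxKernel β ⌈β ^ θ⌉₊ (1 : LGConfig 4 (Matrix.specialUnitaryGroup (Fin 2) ℂ))) ≤
      (∫ U, plaqCostAt (fundamentalRep (Fin 2)) (fun _ => (R : ℤ) + 1) 1 2 U ∂(boxKernel β ⌈β ^ θ⌉₊
        ((Literature.MathematicalPhysics.QuantumLattice.relabelConfig (Literature.MathematicalPhysics.QuantumLattice.edgePerm σ)).symm
          (configShift (fun k => ((R : ℤ) + 1) - x k) η)))) + 2 * β ^ (-1 - θ) := hm
  linarith

end Summit.QuantumFields.YangMills.Cruxes.UVSeamRec.ClassicalResponse.ColdWall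

end
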